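import Summits.CriticalPhenomena.CardyFormulaZ2.Theorems.CardyRotToConfR2SymmetryUpgradeSleSixIsometryInvariance
import Literature.Probability.RandomPlanarGeometry.SLEUniquenessInLaw
import HarnessLib

/-!
# Crux `CardyShadowIsolated` (stmt-CriticalPhenomena-5767), line `registered`: stub 2a —
# reflection covariance of a family of chordal SLE₆ laws

Registered stub `stub_sleSixReflection` of the skeleton `Lines/birth.lean` (namespace
`…Cruxes.CardyShadowIsolated.Birth`) for the shared crux `CardyShadowIsolated` of routes
CardyAnchoredRigidity / CardyLocalRigidity.

**Statement.** For every family `Q` of chordal SLE₆ laws and every Dobrushin domain `D`, the law in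
the mirror domain `D̄ = D.map conj` (marked points `ā, b̄`) is the push-forward of the law in `D`
along `z ↦ z̄` — Werner's symmetry condition (3) in covariance form, the clause that upgrades the
conformal (hence similarity) covariance of the SLE₆ family to full isometry covariance
(`IsConformallyCovariant.isIsometryCovariant_of_conj`).

**Proof.** Both `Q D̄` (hypothesis) and `conj_* (Q D)` (`isSLELaw_map_conj`: reflected Loewner
chain driven by `−W`, symmetry `B ↦ −B` of the driving Brownian motion, Brownian scaling, proved in
`CardyRotToConfR2SymmetryUpgradeSleSixIsometryInvariance.lean`) are chordal SLE₆ laws of `D̄`, and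
two SLE₆ laws of one Dobrushin domain coincide (`IsSLELaw.unique'`, unconditional).

Sources: W. Werner, *Lectures on two-dimensional critical percolation* (2007), §3.2 condition (3);
S. Rohde, O. Schramm, Ann. Math. 161 (2005), §2, §6.
-/

noncomputable section

open MeasureTheory
open Literature.Probability.RandomPlanarGeometry

namespace Summit.CriticalPhenomena.CardyFormulaZ2.Theorems.CardyShadowIsolated

/-- **Stub 2a of line `registered` (reflection covariance of the chordal SLE₆ family).** For every
family `Q` of chordal SLE₆ laws and every Dobrushin domain `D`,
`Q (D.map conj) = conj_* (Q D)`: both sides are SLE₆ laws of the mirror domain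
(`isSLELaw_map_conj`) and the SLE₆ law of a Dobrushin domain is unique (`IsSLELaw.unique'`).
[cite: Werner2007, §3.2 condition (3)] -/
theorem stub_sleSixReflection :
    ∀ Q : ChordalFamily, (∀ D : DobrushinDomain, IsSLELaw 6 D (Q D)) →
      ∀ D : DobrushinDomain, Q (D.map Complex.conjLIE.toHomeomorph) =
        (Q D).map (CurveClass.map (Complex.conjLIE.toHomeomorph : C(ℂ, ℂ))) :=
  fun Q hQ D =>
    (hQ (D.map Complex.conjLIE.toHomeomorph)).unique'
      (CardyRotToConfR2SymmetryUpgrade.IsotropyKillsBeltrami.isSLELaw_map_conj D (Q D) (hQ D))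

end Summit.CriticalPhenomena.CardyFormulaZ2.Theorems.CardyShadowIsolated

end
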